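import Literature.Barriers.AtomisticToContinuum.OneDimensionalHardCoreProofs
import HarnessLib

/-!
# Hard rods, toolkit: Bessel's inequality and Parseval for plane waves on `[0, L]`

`Literature/Barriers/AtomisticToContinuum/` (D-0021 barrier catalogue), sub-problem
`BoseEinsteinCondensation`; part of the typed proof of the rod barrier `OneDimensionalHardRods`
(`OneDimensionalHardCoreRods.lean`, eighth audit of `OneDimensionalHardCore`, 2026-08-16).

Part G of `OneDimensionalHardCoreProofs.lean` proves Bessel's inequality for the plane waves
`e^{2πimx/L}` only against the INDICATOR of an arc (`sum_norm_sq_qCoeff_le`), by an AM–GM trick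
special to indicators. The rod proof needs it twice in general form — for the contraction
property `‖A(t)v‖ ≤ ‖v‖` of Lenard's rod matrix (step (4)) and for the two-step functions of the
deficiency bound (step (5)) — so this file proves, bare-handed and in the style of the Proofs file
(no `Lᵖ` spaces): Parseval for finite plane-wave combinations
(`integral_norm_sq_sum_ez`, `∫₀ᴸ |∑_{m∈S} c_m e_m|² = L ∑ |c_m|²`) and Bessel's inequality for every
bounded measurable `h` (`bessel_ez`, `L ∑_{m∈S} |ĥ(m)|² ≤ ∫₀ᴸ |h|²`, `ĥ(m) = L⁻¹∫₀ᴸ conj(e_m) h`,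
`ezCoeff`), via `0 ≤ ∫|h − ∑ ĥ(m)e_m|² = ∫|h|² − L∑|ĥ(m)|²`.

## References

* [ForresterEtAl2003] P. J. Forrester et al., Phys. Rev. A 67 (2003) 043607: §2.1.2 (the
  plane-wave / Toeplitz structure these estimates serve).
-/

noncomputable section

open MeasureTheory Finset Complex
open scoped BigOperators Real ComplexConjugate

namespace Literature.Barriers.AtomisticToContinuum.BoseGas

section BesselGeneral

variable {L : ℝ}

/-- The `m`-th plane-wave (Fourier) coefficient of `h` on `[0, L]`:
`ĥ(m) = L⁻¹ ∫₀ᴸ conj(e_m) h`. [folklore] -/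
def ezCoeff (L : ℝ) (h : ℝ → ℂ) (m : ℤ) : ℂ :=
  (L : ℂ)⁻¹ * ∫ x in Set.Icc 0 L, conj (ez L m x) * h x

/-- **Parseval for finite plane-wave combinations**: `∫₀ᴸ |∑_{m∈S} c_m e_m|² = L ∑_{m∈S} |c_m|²`
(orthogonality `∫₀ᴸ e_m conj e_{m'} = L δ_{mm'}`). [folklore] -/
theorem integral_norm_sq_sum_ez (hL : 0 < L) (S : Finset ℤ) (c : ℤ → ℂ) :
    ∫ x in Set.Icc 0 L, ‖∑ m ∈ S, c m * ez L m x‖ ^ 2 = L * ∑ m ∈ S, ‖c m‖ ^ 2 := by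
  set g : ℝ → ℂ := fun x => ∑ m ∈ S, c m * ez L m x with hg
  have hpt : ∀ x, ((‖g x‖ ^ 2 : ℝ) : ℂ) =
      ∑ m ∈ S, ∑ m' ∈ S, (c m' * conj (c m)) * ez L (m' - m) x := by
    intro x
    rw [← mul_conj_eq_norm_sq, hg]
    simp only [map_sum, map_mul, Finset.sum_mul, Finset.mul_sum]
    refine Finset.sum_congr rfl fun m _ => Finset.sum_congr rfl fun m' _ => ?_
    rw [← ez_mul_conj_ez]; ring
  have hint2 : ∀ m m' : ℤ, IntegrableOn (fun x => (c m' * conj (c m)) * ez L (m' - m) x)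
      (Set.Icc 0 L) := fun m m' =>
    (continuous_const.mul (continuous_ez L _)).integrableOn_Icc
  have hC : ((∫ x in Set.Icc 0 L, ‖g x‖ ^ 2 : ℝ) : ℂ) = ((L * ∑ m ∈ S, ‖c m‖ ^ 2 : ℝ) : ℂ) := by
    rw [← integral_complex_ofReal]
    simp_rw [hpt]
    rw [integral_finsetSum _ fun m _ => integrable_finsetSum _ fun m' _ => hint2 m m']
    simp_rw [integral_finsetSum _ fun m' _ => hint2 _ m', integral_const_mul,
      integral_ez_Icc hL, sub_eq_zero, mul_ite, mul_zero]
    simp_rw [Finset.sum_ite_eq']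
    push_cast
    rw [Finset.mul_sum]
    refine Finset.sum_congr rfl fun m hm => ?_
    rw [if_pos hm, mul_conj_eq_norm_sq]; push_cast; ring
  exact_mod_cast hC

/-- A finite plane-wave combination is bounded by the sum of the moduli of its coefficients.
[folklore] -/
theorem norm_sum_ez_le (L : ℝ) (S : Finset ℤ) (c : ℤ → ℂ) (x : ℝ) :
    ‖∑ m ∈ S, c m * ez L m x‖ ≤ ∑ m ∈ S, ‖c m‖ := by
  refine (norm_sum_le _ _).trans (Finset.sum_le_sum fun m _ => ?_)
  rw [norm_mul, norm_ez, mul_one]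

/-- **Bessel's inequality for the plane waves on `[0, L]`.** For every bounded measurable
`h : ℝ → ℂ` and every finite set of frequencies, `L ∑_{m∈S} |ĥ(m)|² ≤ ∫₀ᴸ |h|²`
(from `0 ≤ ∫₀ᴸ |h − ∑_{m∈S} ĥ(m) e_m|² = ∫₀ᴸ|h|² − L∑|ĥ(m)|²`). [folklore] -/
theorem bessel_ez (hL : 0 < L) {h : ℝ → ℂ} (hh : Measurable h) {C : ℝ} (hC : ∀ x, ‖h x‖ ≤ C)
    (S : Finset ℤ) :
    L * ∑ m ∈ S, ‖ezCoeff L h m‖ ^ 2 ≤ ∫ x in Set.Icc 0 L, ‖h x‖ ^ 2 := by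
  set q : ℤ → ℂ := ezCoeff L h with hq
  set B : ℝ := ∑ m ∈ S, ‖q m‖ ^ 2 with hB
  set g : ℝ → ℂ := fun x => ∑ m ∈ S, q m * ez L m x with hg
  set Q : ℝ := ∑ m ∈ S, ‖q m‖ with hQ
  have hC0 : 0 ≤ C := (norm_nonneg _).trans (hC 0)
  have hg_cont : Continuous g := continuous_finsetSum _ fun m _ =>
    continuous_const.mul (continuous_ez L m)
  have hg_bd : ∀ x, ‖g x‖ ≤ Q := fun x => norm_sum_ez_le L S q x
  -- integrability facts on `[0, L]`
  have hhI : IntegrableOn h (Set.Icc 0 L) := by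
    refine Integrable.mono' (integrable_const C) hh.aestronglyMeasurable
      (Filter.Eventually.of_forall fun x => hC x)
  have hh2 : IntegrableOn (fun x => ‖h x‖ ^ 2) (Set.Icc 0 L) := by
    refine Integrable.mono' (integrable_const (C ^ 2)) (hh.norm.pow_const 2).aestronglyMeasurable
      (Filter.Eventually.of_forall fun x => ?_)
    rw [Real.norm_eq_abs, abs_of_nonneg (sq_nonneg _)]
    exact pow_le_pow_left₀ (norm_nonneg _) (hC x) 2
  have hg2 : IntegrableOn (fun x => ‖g x‖ ^ 2) (Set.Icc 0 L) := (hg_cont.norm.pow 2).integrableOn_Icc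
  have hhg : IntegrableOn (fun x => h x * conj (g x)) (Set.Icc 0 L) := by
    refine Integrable.mono' (integrable_const (C * Q))
      (hh.mul (Complex.continuous_conj.measurable.comp hg_cont.measurable)).aestronglyMeasurable
      (Filter.Eventually.of_forall fun x => ?_)
    rw [norm_mul, Complex.norm_conj]
    exact mul_le_mul (hC x) (hg_bd x) (norm_nonneg _) hC0
  -- (i) `∫ h conj g = L B`
  have hterm : ∀ m : ℤ, IntegrableOn (fun x => conj (q m) * (conj (ez L m x) * h x))
      (Set.Icc 0 L) := by
    intro m
    have hmeas : Measurable fun x => conj (ez L m x) * h x :=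
      (Complex.continuous_conj.measurable.comp (continuous_ez L m).measurable).mul hh
    have hI : IntegrableOn (fun x => conj (ez L m x) * h x) (Set.Icc 0 L) :=
      Integrable.mono' (integrable_const C) hmeas.aestronglyMeasurable
        (Filter.Eventually.of_forall fun x => by
          show ‖conj (ez L m x) * h x‖ ≤ C
          rw [norm_mul, Complex.norm_conj, norm_ez, one_mul]; exact hC x)
    exact hI.const_mul _
  have h1 : ∫ x in Set.Icc 0 L, h x * conj (g x) = ((L * B : ℝ) : ℂ) := by
    have hpt : ∀ x, h x * conj (g x) = ∑ m ∈ S, conj (q m) * (conj (ez L m x) * h x) := by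
      intro x
      rw [hg]
      simp only [map_sum, map_mul, Finset.mul_sum]
      refine Finset.sum_congr rfl fun m _ => ?_
      ring
    simp_rw [hpt]
    rw [integral_finsetSum _ fun m _ => hterm m]
    simp_rw [integral_const_mul]
    have hcoef : ∀ m : ℤ, ∫ x in Set.Icc 0 L, conj (ez L m x) * h x = (L : ℂ) * q m := by
      intro m
      rw [hq]; unfold ezCoeff
      rw [← mul_assoc, mul_inv_cancel₀ (by exact_mod_cast hL.ne'), one_mul]
    simp_rw [hcoef]
    rw [hB]; push_cast
    rw [Finset.mul_sum]
    refine Finset.sum_congr rfl fun m _ => ?_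
    rw [mul_left_comm, mul_comm ((starRingEnd ℂ) (q m)) (q m), mul_conj_eq_norm_sq]; push_cast; ring
  -- (ii) `∫ ‖g‖² = L B`
  have h2 : ∫ x in Set.Icc 0 L, ‖g x‖ ^ 2 = L * B := integral_norm_sq_sum_ez hL S q
  -- (iii) `0 ≤ ∫ ‖h − g‖² = ∫‖h‖² − L B`
  have hexp : ∀ x, ‖h x - g x‖ ^ 2 = ‖h x‖ ^ 2 + ‖g x‖ ^ 2 - 2 * (h x * conj (g x)).re := by
    intro x
    rw [← Complex.normSq_eq_norm_sq, ← Complex.normSq_eq_norm_sq, ← Complex.normSq_eq_norm_sq,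
      Complex.normSq_sub]
  have hre : ∫ x in Set.Icc 0 L, (h x * conj (g x)).re = L * B := by
    have hre' := integral_re hhg
    rw [h1] at hre'
    simpa only [RCLike.re_to_complex, Complex.ofReal_re] using hre'
  have hkey : ∫ x in Set.Icc 0 L, ‖h x - g x‖ ^ 2 = (∫ x in Set.Icc 0 L, ‖h x‖ ^ 2) - L * B := by
    simp_rw [hexp]
    have hre2 : IntegrableOn (fun x => 2 * (h x * conj (g x)).re) (Set.Icc 0 L) :=
      hhg.re.const_mul 2
    have hA : IntegrableOn (fun x => ‖h x‖ ^ 2 + ‖g x‖ ^ 2) (Set.Icc 0 L) := hh2.add hg2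
    rw [integral_sub hA hre2, integral_add hh2 hg2, integral_const_mul, hre, h2]
    ring
  have hnonneg : 0 ≤ ∫ x in Set.Icc 0 L, ‖h x - g x‖ ^ 2 := integral_nonneg fun x => sq_nonneg _
  rw [hkey] at hnonneg
  linarith

end BesselGeneral

end Literature.Barriers.AtomisticToContinuum.BoseGas

end
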